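import Literature.Analysis.FluidPDE.FluidComputer.VorticityForm
import HarnessLib

/-!
# The helical (Waleffe) decomposition of a truncated Fourier field and the structure of helicity:
# `û = û₊ + û₋`, `ik × û± = ±|k| û±`, `H(k) = |k|(|û₊|² − |û₋|²)`, and the Lei–Lin–Zhou identity
# `d/dt[E_{1/2}(u₊) − E_{1/2}(u₋)] = −2ν[E_{3/2}(u₊) − E_{3/2}(u₋)]` along the Galerkin system

Analysis/FluidPDE (FluidComputer vocabulary) file: ONE definition (`helicalPart`) and theorems, all
PROVED; no named facts (D-0026). HONEST FRAMING as in the rest of this directory: the object is a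
real, incompressible field of Fourier coefficients on `ℤ³` (`ShellTransfer.FourierVelocity`) and the
finite Galerkin system on a mode set `S` (`IsGalerkinSolution`); nothing is claimed about solutions of
the Navier–Stokes PDE, and nothing here is NS-regularity evidence.

## What is printed

* Biferale–Titi 2013, §2 [held: arXiv:1303.1215, p. 4, first three displays]: "the well-known
  helical-Fourier decomposition [Waleffe 1992] … `u(k) = u⁺(k) h⁺(k) + u⁻(k) h⁻(k)` where `h±(k)` are
  the eigenvectors of the curl operator `i k × h±(k) = ±k h±(k)`" (periodic, zero mean); "We then have
  for energy … and helicity … `E = Σ_k |u⁺|² + |u⁻|²`, `ℋ = Σ_k k(|u⁺|² − |u⁻|²)`"; the projector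
  `𝒫±(k) = h± ⊗ h̄± /(h̄±·h±)` "is self-adjoint and commutes with derivatives"; and the helicity
  evolution `dℋ/dt = −ν Σ k³(|u⁺|² − |u⁻|²) + (forcing)` (their normalisation).
* Lei–Lin–Zhou 2015 (ARMA 218), §2 [held: arXiv:1505.00142, p. 5]: for a divergence-free field
  `u = u₊ + u₋`, `u± = ½(u ± D⁻¹∇×u)`, `D = √(−Δ)` ((2.1)); **Prop. 2.1** `∇×u₊ = Du₊`,
  `∇×u₋ = −Du₋`; **Prop. 2.2** (strong orthogonality) `∫ D^{m₁}∂ₜ^{k₁}u₊ · D^{m₂}∂ₜ^{k₂}u₋ = 0`;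
  proof of **Thm 1.1** ("Structure of Helicity", p. 3): `d/dt ∫u·ω = 2ν∫Δu·ω` ((4-2)),
  `∫u·ω = ‖D^{1/2}u₊‖² − ‖D^{1/2}u₋‖²` ((4-3), up to the printed constant),
  `∫Δu·ω = −(‖D^{3/2}u₊‖² − ‖D^{3/2}u₋‖²)` ((4-4)), hence
  `d/dt(½‖D^{1/2}u₊‖² + ν∫₀ᵗ‖D^{3/2}u₊‖²) = d/dt(½‖D^{1/2}u₋‖² + ν∫₀ᵗ‖D^{3/2}u₋‖²)`, i.e.
  **`E_c(u₊) = E_c(u₋) + c₀`** with `E_c(u) = ½‖D^{1/2}u‖² + ν∫₀ᵗ‖D^{1/2}∇u‖²`,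
  `c₀ = ½(‖u₀₊‖²_{Ḣ^{1/2}} − ‖u₀₋‖²_{Ḣ^{1/2}})`.

## What is here (mode by mode on `ℤ³`; `|k| = √(knormSq k)`, `ω̂ = ik × û = (curl û)`)

* `helicalPart s û` — the field with coefficients `½(û(k) + (s/|k|) ω̂(k))`; for `s = 1`, `s = −1`
  these are the helical components `û₊ = 𝒫⁺û`, `û₋ = 𝒫⁻û` (basis-free form of BT13's projector; LLZ's
  `u± = ½(u ± D⁻¹∇×u)` read in Fourier space). It is again real and incompressible (a
  `FourierVelocity`); at `k = 0` (where `1/|k| = 0` by convention) it is `½û(0)`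
  (`helicalPart_coeff_zero`).
* `helicalPart_add_coeff` — `û = û₊ + û₋` (LLZ (2.1), BT13 first display).
* `curl_helicalPart_coeff` — **`ik × û_s = s|k| û_s`** for every `s` with `s·s = 1` (LLZ Prop. 2.1
  `∇×u± = ±Du±`; BT13 `ik × h± = ±k h±`); `helicalPart_coeff_eq_weight_mul_curl` (`u₊ = D⁻¹∇×u₊`);
  `helicalPart_helicalPart_same/_opposite` — `𝒫±𝒫± = 𝒫±`, `𝒫∓𝒫± = 0` off the zero mode (the
  `𝒫±` are complementary projections); `curl_coeff_eq_sqrt_mul_sub` — `ω̂ = |k|(û₊ − û₋)`.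
* `sum_helicalPart_mul_conj_eq_zero` — **modal strong orthogonality** `Σ_j û₊(k)_j conj û₋(k)_j = 0`
  for `k ≠ 0` (LLZ Prop. 2.2, the case `m₁ = m₂ = k₁ = k₂ = 0`, mode by mode; the powers of `D`
  and `∂ₜ` of the printed statement act on each mode by scalars).
* `modalEnergy_eq_add_helical` — **`E(k) = E(û₊)(k) + E(û₋)(k)`** (`k ≠ 0`; BT13 energy line);
  `modalHelicity_eq_helical` — **`H(k) = 2|k|(E(û₊)(k) − E(û₋)(k))`** (all `k`; BT13 helicity line,
  LLZ (4-3) mode by mode; with `modalEnergy = ½|·|²` this is `H(k) = |k|(|û₊|² − |û₋|²)`);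
  `modalEnergy_helicalPart` — the closed form `E(û_s)(k) = ½E(k) + s H(k)/(4|k|)` (`k ≠ 0`);
  `modalHelicity_eq_of_neg_zero/_of_pos_zero` — a homochiral mode has maximal helicity
  `H(k) = ±2|k|E(k)` (equality in `EnergyParseval.abs_modalHelicity_le`).
* truncated sums over a mode set `S`: `truncHelicity_eq_helical` — `H_S = 2(A₊ − A₋)`,
  `A± = Σ_{k∈S}|k|E(û±)(k)` (`= ½‖D^{1/2}u±‖²`, LLZ (4-3)); `helicityDissipation_eq_helical` —
  `Σ_{k∈S}|k|²H(k) = 2(B₊ − B₋)`, `B± = Σ_{k∈S}|k|³E(û±)(k)` (`= ½‖D^{3/2}u±‖²`, LLZ (4-4));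
  `truncEnergy_eq_add_helical` — `E_S = E_S(û₊) + E_S(û₋)` for zero-mean fields (BT13 energy line).
* **`hasDerivAt_criticalEnergy_sub`** — LLZ15 Thm 1.1 in differentiated form along every unforced
  Galerkin solution supported in a symmetric `S` (any viscosity `ν`, any pressure multiplier):
  `d/dt (A₊ − A₋) = −2ν (B₊ − B₋)`, from the helicity balance of the Galerkin system
  (`HelicityBalance.hasDerivAt_truncHelicity_unforced`, = LLZ (4-2)) and the two identities above;
  **`criticalEnergy_posHelical_eq`** — the integrated statement as printed,
  `A₊(t) + 2ν∫₀ᵗB₊ = (A₋(t) + 2ν∫₀ᵗB₋) + (A₊(0) − A₋(0))`, i.e. `E_c(u₊) = E_c(u₋) + c₀`.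

Deviations / scope (faithfulness): (i) SETTING — LLZ15 is stated on `ℝ³` with `D = √(−Δ)` for
`H¹ ∩ H²` solutions; here the same algebra is carried out mode by mode on the periodic lattice `ℤ³`
(BT13's setting) and the dynamics is the finite Galerkin truncation of this directory, for which the
helicity balance is an exact theorem of the tree; `-- TODO(general form): ℝ³ / full NS on T³`
(needs the helical multiplier `û ↦ ½(û ± ik×û/|k|)` as an operator on `Ḣ^s(ℝ³)`; not in the tree).
(ii) NORMALISATION — `modalEnergy = ½|û(k)|²` (GalerkinEnergyBalance), so BT13's `|u±(k)|²` is
`2E(û±)(k)` and LLZ's `½‖D^{1/2}u±‖²` is `A±`; BT13's helical amplitudes `u±(k) ∈ ℂ` w.r.t. a chosen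
basis `h±(k)` are replaced by the basis-free vectors `û±(k) = u±(k)h±(k) ∈ ℂ³` (no choice of
`μ̂(k)` is needed, and reality `û±(−k) = conj û±(k)` is automatic). (iii) The zero mode: BT13/LLZ
assume zero mean; here `k = 0` is allowed and carries weight `|k| = 0` in every identity except the
energy split, which is stated for `k ≠ 0` / zero-mean fields. WHAT THIS IS NOT: not the
Biferale–Titi theorem (global regularity of the helical-DECIMATED system) and not a statement about
Navier–Stokes regularity; for true NS the homochiral subspace is NOT invariant (heterochiral triads,
`HelicalTriadInstability`), only the identity `E_c(u₊) − E_c(u₋) = c₀` survives.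

## Tree / Mathlib search

Tree (used): `ShellTransfer.FourierVelocity`, `kdot`, `kcross`, `curl`, `curl_coeff`, `knormSq`,
`knormSq_eq_zero_iff`, `modalEnergy`, `truncEnergy`, `modalHelicity`, `truncHelicity`,
`helicityDissipation`, `curlPair`, `curlPair_swap`, `modalHelicity_eq_curlPair`, `normSq_kcross_sum`,
`kcross_kcross`, `kcross_const_mul'`, `kcross_add`, `IsGalerkinSolution`, `IsSupportedOn`,
`hasDerivAt_truncHelicity_unforced`, `hasDerivAt_modalEnergy_galerkin`,
`hasDerivAt_modalHelicity_galerkin`. Searched (`lean search` / `rg`): `helical`, `chiral`, `Waleffe`,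
`LeiLinZhou`, `BiferaleTiti` — only `HelicalTriadInstability` (Waleffe's single-triad ODE; no
decomposition of a field), `[cite: BiferaleTiti2013]` in `Barriers/…/ExactRestrictionSparseCeiling`,
the helicity balances `TorusNSHelicityBalance` (classical NS on `T³`) / `HelicityBalance` (Galerkin) /
`euler_helicity_conservation` (`ℝ³`); no helical projection anywhere in the tree.

## References

* L. Biferale, E. S. Titi, *On the global regularity of a helical-decimated version of the 3D
  Navier–Stokes equations*, J. Stat. Phys. 151 (2013) 1089–1098; arXiv:1303.1215, §2.
  [`BiferaleTiti2013`]
* Z. Lei, F.-H. Lin, Y. Zhou, *Structure of helicity and global solutions of incompressible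
  Navier–Stokes equation*, Arch. Ration. Mech. Anal. 218 (2015) 1417–1430; arXiv:1505.00142, §1
  Thm 1.1, §2 Props. 2.1–2.2. [`LeiLinZhou2015`]
* F. Waleffe, *The nature of triad interactions in homogeneous turbulence*, Phys. Fluids A 4 (1992)
  350–363 (the helical decomposition). [`Waleffe1992`]
* R. H. Kraichnan, *Helical turbulence and absolute equilibrium*, J. Fluid Mech. 59 (1973) 745–752
  (helicity of the truncated system). [`Kraichnan1973`]
-/

noncomputable section

namespace Literature.Analysis.FluidPDE.FluidComputer

open Complex ComplexConjugate Finset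
open scoped BigOperators

namespace ShellTransfer

/-! ## Lattice-vector preliminaries -/

/-- `|−k|² = |k|²`. [folklore] -/
private theorem knormSq_neg_hd (k : Fin 3 → ℤ) : knormSq (-k) = knormSq k := by
  unfold knormSq
  refine Finset.sum_congr rfl fun i _ => ?_
  simp only [Pi.neg_apply, Int.cast_neg]
  ring

/-- `|k| · |k| = |k|²` for `|k| = √(knormSq k)`. [folklore] -/
private theorem sqrt_knormSq_mul_self (k : Fin 3 → ℤ) :
    Real.sqrt (knormSq k) * Real.sqrt (knormSq k) = knormSq k :=
  Real.mul_self_sqrt (knormSq_nonneg k)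

/-- `k ≠ 0 ⇒ |k| ≠ 0`. [folklore] -/
private theorem sqrt_knormSq_ne_zero {k : Fin 3 → ℤ} (hk : k ≠ 0) : Real.sqrt (knormSq k) ≠ 0 := by
  intro h
  have h2 : knormSq k = 0 := by rw [← sqrt_knormSq_mul_self, h, mul_zero]
  exact hk ((knormSq_eq_zero_iff k).mp h2)

/-- **`ik × (ik × a) = |k|² a`** for a divergence-free vector `a` (`k·a = 0`): the Fourier symbol of
`curl curl = −Δ` on solenoidal fields (BAC–CAB, `kcross_kcross`). [folklore] -/
private theorem I_mul_kcross_curlVec (k : Fin 3 → ℤ) (a : Fin 3 → ℂ) (hdiv : kdot k a = 0) (j : Fin 3) :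
    I * kcross k (fun i => I * kcross k a i) j = (knormSq k : ℂ) * a j := by
  rw [kcross_const_mul']
  beta_reduce
  rw [kcross_kcross, hdiv, zero_mul, zero_sub]
  have hI : I * I = -1 := Complex.I_mul_I
  linear_combination (-((knormSq k : ℂ) * a j)) * hI

/-- The curl pairing of a vector with itself is REAL: `Σ_j a_j conj(ik × a)_j = conj(itself)`
(`curlPair_swap` with `a = b`: the operator `ik ×` is Hermitian). [folklore] -/
private theorem conj_curlPair_self (k : Fin 3 → ℤ) (a : Fin 3 → ℂ) :
    conj (curlPair k a a) = curlPair k a a := by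
  rw [← curlPair_swap]

/-! ## The helical components -/

/-- **The helical component of sign `s`** of a real incompressible coefficient field `û`: the field
with coefficients `½(û(k) + (s/|k|)·ω̂(k))`, `ω̂ = ik × û`, `|k| = √(knormSq k)` (and `s/|k| = 0` at
`k = 0`). For `s = 1` / `s = −1` this is the positive / negative helical part `û₊ = 𝒫⁺û`,
`û₋ = 𝒫⁻û` of the Waleffe decomposition — Lei–Lin–Zhou's `u± = ½(u ± D⁻¹∇×u)` read mode by mode.
It is again real (`|−k| = |k|`, reality of `ω̂`) and incompressible (`k·ω̂ = 0`).
[cite: LeiLinZhou2015, §2 (2.1) (arXiv:1505.00142 p. 5)]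
[cite: BiferaleTiti2013, §2 first display and the projector `𝒫±` (arXiv:1303.1215 p. 4)] -/
def helicalPart (s : ℝ) (U : FourierVelocity) : FourierVelocity where
  coeff k j := (1 / 2 : ℂ) * (U.coeff k j + ((s / Real.sqrt (knormSq k) : ℝ) : ℂ) * (curl U).coeff k j)
  reality k i := by
    rw [U.reality k i, (curl U).reality k i, knormSq_neg_hd]
    simp only [map_mul, map_add, map_div₀, map_one, Complex.conj_ofReal, map_ofNat]
  divFree k := by
    have h1 : ∑ i, ((k i : ℤ) : ℂ) * U.coeff k i = 0 := U.divFree k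
    have h2 : ∑ i, ((k i : ℤ) : ℂ) * (curl U).coeff k i = 0 := (curl U).divFree k
    have e : ∑ i, ((k i : ℤ) : ℂ) *
        ((1 / 2 : ℂ) * (U.coeff k i + ((s / Real.sqrt (knormSq k) : ℝ) : ℂ) * (curl U).coeff k i)) =
        (1 / 2 : ℂ) * (∑ i, ((k i : ℤ) : ℂ) * U.coeff k i) +
          (1 / 2 : ℂ) * ((s / Real.sqrt (knormSq k) : ℝ) : ℂ) *
            ∑ i, ((k i : ℤ) : ℂ) * (curl U).coeff k i := by
      rw [Finset.mul_sum, Finset.mul_sum, ← Finset.sum_add_distrib]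
      refine Finset.sum_congr rfl fun i _ => ?_
      ring
    rw [e, h1, h2, mul_zero, mul_zero, add_zero]

variable (U : FourierVelocity)

/-- The coefficients of `helicalPart s û`: `½(û(k)_j + (s/|k|)·(ik × û(k))_j)` (unfolding lemma of the
definition). [cite: LeiLinZhou2015, §2 (2.1) (arXiv:1505.00142 p. 5)] -/
theorem helicalPart_coeff (s : ℝ) (k : Fin 3 → ℤ) (j : Fin 3) :
    (helicalPart s U).coeff k j =
      (1 / 2 : ℂ) * (U.coeff k j + ((s / Real.sqrt (knormSq k) : ℝ) : ℂ) * (I * kcross k (U.coeff k) j)) :=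
  rfl

/-- **`û = û₊ + û₋`** coefficientwise. [cite: LeiLinZhou2015, §2 (2.1) (arXiv:1505.00142 p. 5)]
[cite: BiferaleTiti2013, §2 first display (arXiv:1303.1215 p. 4)] -/
theorem helicalPart_add_coeff (k : Fin 3 → ℤ) (j : Fin 3) :
    (helicalPart 1 U).coeff k j + (helicalPart (-1) U).coeff k j = U.coeff k j := by
  rw [helicalPart_coeff, helicalPart_coeff]
  push_cast
  ring

/-- More generally `û_s + û_{−s} = û` (the two weights cancel). [cite: LeiLinZhou2015, §2 (2.1) (arXiv:1505.00142 p. 5)] -/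
theorem helicalPart_add_coeff' (s : ℝ) (k : Fin 3 → ℤ) (j : Fin 3) :
    (helicalPart s U).coeff k j + (helicalPart (-s) U).coeff k j = U.coeff k j := by
  rw [helicalPart_coeff, helicalPart_coeff]
  push_cast
  ring

/-- At the zero mode the helical weight vanishes: `û_s(0) = ½ û(0)` (BT13 work with zero mean,
`u(0) = 0`, where both sides vanish). [cite: BiferaleTiti2013, §2 first paragraph (zero mode) (arXiv:1303.1215 p. 4)] -/
theorem helicalPart_coeff_zero (s : ℝ) (j : Fin 3) :
    (helicalPart s U).coeff 0 j = (1 / 2 : ℂ) * U.coeff 0 j := by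
  rw [helicalPart_coeff]
  have h0 : kcross 0 (U.coeff 0) j = 0 := by
    fin_cases j <;> simp [kcross]
  rw [h0, mul_zero, mul_zero, add_zero]

/-- **The curl eigen-relation `ik × û_s(k) = s|k| û_s(k)`** for `s = ±1` (`s·s = 1`): the helical
components are eigenvectors of the curl, `∇×u₊ = Du₊`, `∇×u₋ = −Du₋`.
[cite: LeiLinZhou2015, Prop. 2.1 (arXiv:1505.00142 p. 5)]
[cite: BiferaleTiti2013, §2 `ik × h±(k) = ±k h±(k)` (arXiv:1303.1215 p. 4)] -/
theorem curl_helicalPart_coeff {s : ℝ} (hs : s * s = 1) (k : Fin 3 → ℤ) (j : Fin 3) :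
    (curl (helicalPart s U)).coeff k j =
      ((s * Real.sqrt (knormSq k) : ℝ) : ℂ) * (helicalPart s U).coeff k j := by
  by_cases hk : k = 0
  · subst hk
    rw [curl_coeff]
    have h0 : kcross 0 ((helicalPart s U).coeff 0) j = 0 := by
      fin_cases j <;> simp [kcross]
    have hq : knormSq (0 : Fin 3 → ℤ) = 0 := (knormSq_eq_zero_iff 0).mpr rfl
    rw [h0, hq, Real.sqrt_zero, mul_zero, mul_zero]
    push_cast
    rw [zero_mul]
  · have hr : Real.sqrt (knormSq k) ≠ 0 := sqrt_knormSq_ne_zero hk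
    have hdiv : kdot k (U.coeff k) = 0 := U.divFree k
    -- `ik × û_s = ½(ik × û + (s/|k|) ik × (ik × û)) = ½(ω̂ + (s/|k|)|k|² û)`
    have e1 : (curl (helicalPart s U)).coeff k j =
        (1 / 2 : ℂ) * (I * kcross k (U.coeff k) j +
          ((s / Real.sqrt (knormSq k) : ℝ) : ℂ) * ((knormSq k : ℂ) * U.coeff k j)) := by
      rw [curl_coeff]
      have ec : (helicalPart s U).coeff k = fun i => (1 / 2 : ℂ) *
          (U.coeff k i + ((s / Real.sqrt (knormSq k) : ℝ) : ℂ) * (I * kcross k (U.coeff k) i)) :=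
        funext fun i => rfl
      rw [ec, kcross_const_mul']
      beta_reduce
      rw [kcross_add]
      beta_reduce
      rw [kcross_const_mul']
      beta_reduce
      rw [← I_mul_kcross_curlVec k (U.coeff k) hdiv j]
      ring
    rw [e1, helicalPart_coeff]
    have hq : ((knormSq k : ℝ) : ℂ) = ((Real.sqrt (knormSq k) : ℝ) : ℂ) * ((Real.sqrt (knormSq k) : ℝ) : ℂ) := by
      rw [← Complex.ofReal_mul, sqrt_knormSq_mul_self]
    have hrC : ((Real.sqrt (knormSq k) : ℝ) : ℂ) ≠ 0 := by exact_mod_cast hr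
    have hsC : ((s : ℝ) : ℂ) * ((s : ℝ) : ℂ) = 1 := by exact_mod_cast hs
    push_cast
    rw [hq]
    field_simp
    linear_combination (-(I * kcross k (U.coeff k) j)) * hsC

/-- `û_s` written back from its curl: `û_s(k) = (s/|k|)·(ik × û_s(k))` for `k ≠ 0`, `s·s = 1`
(LLZ: `u₊ = D⁻¹∇×u₊`). [cite: LeiLinZhou2015, Prop. 2.2 proof, first display (arXiv:1505.00142 p. 5)] -/
theorem helicalPart_coeff_eq_weight_mul_curl {s : ℝ} (hs : s * s = 1) {k : Fin 3 → ℤ} (hk : k ≠ 0)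
    (j : Fin 3) :
    (helicalPart s U).coeff k j =
      ((s / Real.sqrt (knormSq k) : ℝ) : ℂ) * (curl (helicalPart s U)).coeff k j := by
  rw [curl_helicalPart_coeff U hs]
  have hr : Real.sqrt (knormSq k) ≠ 0 := sqrt_knormSq_ne_zero hk
  have hrC : ((Real.sqrt (knormSq k) : ℝ) : ℂ) ≠ 0 := by exact_mod_cast hr
  have hsC : ((s : ℝ) : ℂ) * ((s : ℝ) : ℂ) = 1 := by exact_mod_cast hs
  push_cast
  field_simp
  linear_combination (-(helicalPart s U).coeff k j) * hsC

/-- **`𝒫_s 𝒫_s = 𝒫_s` off the zero mode**: the helical component of sign `s` of `û_s` is `û_s`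
itself (`k ≠ 0`, `s·s = 1`). [cite: BiferaleTiti2013, §2 projector `𝒫±` (arXiv:1303.1215 p. 4)] -/
theorem helicalPart_helicalPart_same {s : ℝ} (hs : s * s = 1) {k : Fin 3 → ℤ} (hk : k ≠ 0)
    (j : Fin 3) :
    (helicalPart s (helicalPart s U)).coeff k j = (helicalPart s U).coeff k j := by
  have e : (helicalPart s (helicalPart s U)).coeff k j = (1 / 2 : ℂ) *
      ((helicalPart s U).coeff k j +
        ((s / Real.sqrt (knormSq k) : ℝ) : ℂ) * (curl (helicalPart s U)).coeff k j) := rfl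
  rw [e, ← helicalPart_coeff_eq_weight_mul_curl U hs hk]
  ring

/-- **`𝒫_{−s} 𝒫_s = 0` off the zero mode**: `û_s` has no component of the opposite sign
(`k ≠ 0`, `s·s = 1`). [cite: BiferaleTiti2013, §2 projector `𝒫±` (arXiv:1303.1215 p. 4)] -/
theorem helicalPart_helicalPart_opposite {s : ℝ} (hs : s * s = 1) {k : Fin 3 → ℤ} (hk : k ≠ 0)
    (j : Fin 3) :
    (helicalPart (-s) (helicalPart s U)).coeff k j = 0 := by
  have e : (helicalPart (-s) (helicalPart s U)).coeff k j = (1 / 2 : ℂ) *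
      ((helicalPart s U).coeff k j +
        ((-s / Real.sqrt (knormSq k) : ℝ) : ℂ) * (curl (helicalPart s U)).coeff k j) := rfl
  have h := helicalPart_coeff_eq_weight_mul_curl U hs hk j
  rw [e]
  push_cast at h ⊢
  rw [h]
  ring

/-! ## Strong orthogonality and the modal energy / helicity identities -/

/-- The curl splits over the helical components: `ω̂(k) = ik × û₊(k) + ik × û₋(k)`
(`∇×u = ∇×u₊ + ∇×u₋`, first line of the proof of (4-3)).
[cite: LeiLinZhou2015, proof of Thm 1.1, display before (4-3) (arXiv:1505.00142 p. 5)] -/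
theorem curl_coeff_eq_add_helical (k : Fin 3 → ℤ) (j : Fin 3) :
    (curl U).coeff k j = (curl (helicalPart 1 U)).coeff k j + (curl (helicalPart (-1) U)).coeff k j := by
  rw [curl_coeff, curl_coeff, curl_coeff]
  have e : U.coeff k = fun i => (helicalPart 1 U).coeff k i + (helicalPart (-1) U).coeff k i :=
    funext fun i => (helicalPart_add_coeff U k i).symm
  rw [e, kcross_add]
  ring

/-- **`ω̂(k) = |k|(û₊(k) − û₋(k))`** — the vorticity in the helical variables
(`∇×u = D u₊ − D u₋`). [cite: LeiLinZhou2015, Prop. 2.1 / proof of Thm 1.1 (arXiv:1505.00142 p. 5)] -/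
theorem curl_coeff_eq_sqrt_mul_sub (k : Fin 3 → ℤ) (j : Fin 3) :
    (curl U).coeff k j =
      ((Real.sqrt (knormSq k) : ℝ) : ℂ) * ((helicalPart 1 U).coeff k j - (helicalPart (-1) U).coeff k j) := by
  rw [curl_coeff_eq_add_helical, curl_helicalPart_coeff U (by norm_num : (1 : ℝ) * 1 = 1),
    curl_helicalPart_coeff U (by norm_num : (-1 : ℝ) * -1 = 1)]
  push_cast
  ring

/-- `Σ_j |v̂(k)_j|²`-type sums as conj-products: `↑E(v̂)(k) = ½ Σ_j v̂_j conj v̂_j`. [folklore] -/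
private theorem ofReal_modalEnergy_eq (V : FourierVelocity) (k : Fin 3 → ℤ) :
    ((modalEnergy V k : ℝ) : ℂ) = (1 / 2 : ℂ) * ∑ j, V.coeff k j * conj (V.coeff k j) := by
  unfold modalEnergy
  push_cast
  congr 1
  refine Finset.sum_congr rfl fun j _ => ?_
  rw [Complex.normSq_eq_conj_mul_self]
  ring

/-- `↑H(k) = ½ (Z + conj Z)`, `Z = Σ_j û_j conj ω̂_j`. [folklore] -/
private theorem ofReal_modalHelicity_eq (k : Fin 3 → ℤ) :
    ((modalHelicity U k : ℝ) : ℂ) =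
      (1 / 2 : ℂ) * ((∑ j, U.coeff k j * conj ((curl U).coeff k j)) +
        conj (∑ j, U.coeff k j * conj ((curl U).coeff k j))) := by
  unfold modalHelicity
  rw [Complex.add_conj, Complex.ofReal_mul]
  push_cast
  ring

/-- **Modal strong orthogonality**: `Σ_j û₊(k)_j · conj û₋(k)_j = 0` for `k ≠ 0` — the Hermitian
operator `ik ×` has the distinct eigenvalues `±|k|` on the two components (computed directly:
`|û|² − |ω̂|²/|k|² = 0` by Lagrange's identity, and the cross term is `conj z − z` for the REAL number
`z = Σ_j û_j conj ω̂_j`). [cite: LeiLinZhou2015, Prop. 2.2 (arXiv:1505.00142 p. 5)] -/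
theorem sum_helicalPart_mul_conj_eq_zero {k : Fin 3 → ℤ} (hk : k ≠ 0) :
    ∑ j, (helicalPart 1 U).coeff k j * conj ((helicalPart (-1) U).coeff k j) = 0 := by
  have hq0 : knormSq k ≠ 0 := fun h => hk ((knormSq_eq_zero_iff k).mp h)
  -- the real identity (1/|k|)² |k|² = 1, cast to ℂ
  have hc1r : (1 / Real.sqrt (knormSq k)) * (1 / Real.sqrt (knormSq k)) * knormSq k = 1 := by
    calc (1 / Real.sqrt (knormSq k)) * (1 / Real.sqrt (knormSq k)) * knormSq k
        = knormSq k / (Real.sqrt (knormSq k) * Real.sqrt (knormSq k)) := by ring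
      _ = 1 := by rw [sqrt_knormSq_mul_self, div_self hq0]
  set c : ℂ := ((1 / Real.sqrt (knormSq k) : ℝ) : ℂ) with hc
  have hc1 : c * c * ((knormSq k : ℝ) : ℂ) = 1 := by rw [hc]; exact_mod_cast hc1r
  have hcreal : conj c = c := by rw [hc, Complex.conj_ofReal]
  have hcoef1 : ∀ j, (helicalPart 1 U).coeff k j = (1 / 2 : ℂ) * (U.coeff k j + c * (curl U).coeff k j) :=
    fun j => rfl
  have hcoef2 : ∀ j, (helicalPart (-1) U).coeff k j =
      (1 / 2 : ℂ) * (U.coeff k j - c * (curl U).coeff k j) := by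
    intro j
    have e : (helicalPart (-1) U).coeff k j =
        (1 / 2 : ℂ) * (U.coeff k j + ((-1 / Real.sqrt (knormSq k) : ℝ) : ℂ) * (curl U).coeff k j) := rfl
    rw [e, hc]
    push_cast
    ring
  -- Σ a conj a = 2E, Σ w conj w = |k|²·2E, and z = Σ a conj w is real
  have hA : ∑ j, U.coeff k j * conj (U.coeff k j) = 2 * ((modalEnergy U k : ℝ) : ℂ) := by
    rw [ofReal_modalEnergy_eq]; ring
  have hW : ∑ j, (curl U).coeff k j * conj ((curl U).coeff k j) =
      ((knormSq k : ℝ) : ℂ) * (2 * ((modalEnergy U k : ℝ) : ℂ)) := by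
    have h := ofReal_modalEnergy_eq (curl U) k
    rw [modalEnergy_curl, Complex.ofReal_mul] at h
    linear_combination (-2 : ℂ) * h
  have hz : conj (∑ j, U.coeff k j * conj ((curl U).coeff k j)) =
      ∑ j, U.coeff k j * conj ((curl U).coeff k j) :=
    conj_curlPair_self k (U.coeff k)
  rw [Fin.sum_univ_three] at hA hW hz
  simp only [map_add, map_mul, Complex.conj_conj] at hz
  rw [Fin.sum_univ_three, hcoef1, hcoef1, hcoef1, hcoef2, hcoef2, hcoef2]
  simp only [map_mul, map_sub, hcreal, map_div₀, map_one, map_ofNat]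
  linear_combination (1 / 4 : ℂ) * hA - (1 / 4 : ℂ) * c * c * hW + (c / 4) * hz -
    (1 / 2 : ℂ) * ((modalEnergy U k : ℝ) : ℂ) * hc1

/-- **`E(k) = E(û₊)(k) + E(û₋)(k)`** for `k ≠ 0`: the energy splits over the helical components
(`E = Σ_k |u⁺|² + |u⁻|²`; Pythagoras with `sum_helicalPart_mul_conj_eq_zero`).
[cite: BiferaleTiti2013, §2 second display, energy line (arXiv:1303.1215 p. 4)] -/
theorem modalEnergy_eq_add_helical {k : Fin 3 → ℤ} (hk : k ≠ 0) :
    modalEnergy U k = modalEnergy (helicalPart 1 U) k + modalEnergy (helicalPart (-1) U) k := by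
  apply Complex.ofReal_injective
  have ho := sum_helicalPart_mul_conj_eq_zero U hk
  have ho' : conj (∑ j, (helicalPart 1 U).coeff k j * conj ((helicalPart (-1) U).coeff k j)) = 0 := by
    rw [ho, map_zero]
  rw [Fin.sum_univ_three] at ho ho'
  simp only [map_add, map_mul, Complex.conj_conj] at ho'
  have hE := ofReal_modalEnergy_eq U k
  rw [Fin.sum_univ_three, ← helicalPart_add_coeff U k 0, ← helicalPart_add_coeff U k 1,
    ← helicalPart_add_coeff U k 2] at hE
  have hEp := ofReal_modalEnergy_eq (helicalPart 1 U) k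
  have hEm := ofReal_modalEnergy_eq (helicalPart (-1) U) k
  rw [Fin.sum_univ_three] at hEp hEm
  simp only [map_add] at hE
  rw [Complex.ofReal_add]
  linear_combination hE - hEp - hEm + (1 / 2 : ℂ) * ho + (1 / 2 : ℂ) * ho'

/-- **`H(k) = 2|k|(E(û₊)(k) − E(û₋)(k))`**, i.e. `H(k) = |k|(|û₊(k)|² − |û₋(k)|²)` with
`E = ½|·|²`, for every mode (the helicity line `ℋ = Σ_k k(|u⁺|² − |u⁻|²)`; LLZ (4-3) mode by mode:
substitute `û = û₊ + û₋`, `ω̂ = |k|(û₊ − û₋)` into `H = Re Σ û conj ω̂`; the mixed terms are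
`Re(conj z − z) = 0`, no orthogonality needed).
[cite: BiferaleTiti2013, §2 second display, helicity line (arXiv:1303.1215 p. 4)]
[cite: LeiLinZhou2015, (4-3) (arXiv:1505.00142 p. 5)] -/
theorem modalHelicity_eq_helical (k : Fin 3 → ℤ) :
    modalHelicity U k =
      2 * Real.sqrt (knormSq k) * (modalEnergy (helicalPart 1 U) k - modalEnergy (helicalPart (-1) U) k) := by
  apply Complex.ofReal_injective
  have hH := ofReal_modalHelicity_eq U k
  rw [Fin.sum_univ_three, curl_coeff_eq_sqrt_mul_sub U k 0, curl_coeff_eq_sqrt_mul_sub U k 1,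
    curl_coeff_eq_sqrt_mul_sub U k 2, ← helicalPart_add_coeff U k 0, ← helicalPart_add_coeff U k 1,
    ← helicalPart_add_coeff U k 2] at hH
  simp only [map_add, map_sub, map_mul, Complex.conj_conj, Complex.conj_ofReal] at hH
  have hEp := ofReal_modalEnergy_eq (helicalPart 1 U) k
  have hEm := ofReal_modalEnergy_eq (helicalPart (-1) U) k
  rw [Fin.sum_univ_three] at hEp hEm
  rw [hH]
  push_cast
  linear_combination (-2 * ((Real.sqrt (knormSq k) : ℝ) : ℂ)) * hEp +
    (2 * ((Real.sqrt (knormSq k) : ℝ) : ℂ)) * hEm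

/-- **Closed form of the helical modal energies**: `E(û_s)(k) = ½E(k) + s·H(k)/(4|k|)` for `k ≠ 0`
and `s·s = 1`; equivalently BT13's `|u±(k)|² = ½(|û(k)|² ± H(k)/|k|)` (solve the two linear
relations `E = E₊ + E₋`, `H = 2|k|(E₊ − E₋)`).
[cite: BiferaleTiti2013, §2 second display (arXiv:1303.1215 p. 4)] -/
theorem modalEnergy_helicalPart {s : ℝ} (hs : s * s = 1) {k : Fin 3 → ℤ} (hk : k ≠ 0) :
    modalEnergy (helicalPart s U) k =
      (1 / 2) * modalEnergy U k + s / (4 * Real.sqrt (knormSq k)) * modalHelicity U k := by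
  have hr : Real.sqrt (knormSq k) ≠ 0 := sqrt_knormSq_ne_zero hk
  have h1 := modalEnergy_eq_add_helical U hk
  have h2 := modalHelicity_eq_helical U k
  rcases mul_self_eq_one_iff.mp hs with rfl | rfl
  · rw [h2, h1]
    field_simp
    ring
  · rw [h2, h1]
    field_simp
    ring

/-- `|k|·E(û_s)(k) = ½|k|E(k) + (s/4)H(k)` for ALL modes (at `k = 0` both sides vanish up to
`H(0) = 0`); `s·s = 1` — the `|k|`-weighted form of `|u±(k)|² = ½(|û(k)|² ± H(k)/|k|)`.
[cite: BiferaleTiti2013, §2 second display (arXiv:1303.1215 p. 4)] -/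
theorem sqrt_mul_modalEnergy_helicalPart {s : ℝ} (hs : s * s = 1) (k : Fin 3 → ℤ) :
    Real.sqrt (knormSq k) * modalEnergy (helicalPart s U) k =
      (1 / 2) * Real.sqrt (knormSq k) * modalEnergy U k + s / 4 * modalHelicity U k := by
  by_cases hk : k = 0
  · subst hk
    have hq : knormSq (0 : Fin 3 → ℤ) = 0 := (knormSq_eq_zero_iff 0).mpr rfl
    have hH : modalHelicity U 0 = 0 := by
      unfold modalHelicity
      have h0 : ∀ j, (curl U).coeff 0 j = 0 := by
        intro j; rw [curl_coeff]; fin_cases j <;> simp [kcross]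
      rw [Finset.sum_eq_zero fun j _ => by rw [h0 j, map_zero, mul_zero], Complex.zero_re]
    rw [hq, Real.sqrt_zero, hH]
    ring
  · have hr : Real.sqrt (knormSq k) ≠ 0 := sqrt_knormSq_ne_zero hk
    rw [modalEnergy_helicalPart U hs hk]
    field_simp

/-- A **negatively-homochiral-free mode has maximal helicity**: `û₋(k) = 0 ⇒ H(k) = 2|k|E(k)`
(equality in the realizability bound `|H(k)| ≤ 2|k|E(k)`, `EnergyParseval.abs_modalHelicity_le`).
[cite: BiferaleTiti2013, §2 (sign-definite helicity of the decimated system) (arXiv:1303.1215 p. 4)] -/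
theorem modalHelicity_eq_of_neg_zero {k : Fin 3 → ℤ} (hk : k ≠ 0)
    (h : ∀ j, (helicalPart (-1) U).coeff k j = 0) :
    modalHelicity U k = 2 * Real.sqrt (knormSq k) * modalEnergy U k := by
  have hE : modalEnergy (helicalPart (-1) U) k = 0 := by
    unfold modalEnergy
    rw [Finset.sum_eq_zero fun j _ => by rw [h j, map_zero], mul_zero]
  rw [modalHelicity_eq_helical, modalEnergy_eq_add_helical U hk, hE, add_zero, sub_zero]

/-- Symmetrically `û₊(k) = 0 ⇒ H(k) = −2|k|E(k)` (a purely negative-helical mode has minimal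
helicity). [cite: BiferaleTiti2013, §2 (sign-definite helicity of the decimated system) (arXiv:1303.1215 p. 4)] -/
theorem modalHelicity_eq_of_pos_zero {k : Fin 3 → ℤ} (hk : k ≠ 0)
    (h : ∀ j, (helicalPart 1 U).coeff k j = 0) :
    modalHelicity U k = -(2 * Real.sqrt (knormSq k) * modalEnergy U k) := by
  have hE : modalEnergy (helicalPart 1 U) k = 0 := by
    unfold modalEnergy
    rw [Finset.sum_eq_zero fun j _ => by rw [h j, map_zero], mul_zero]
  rw [modalHelicity_eq_helical, modalEnergy_eq_add_helical U hk, hE, zero_add, zero_sub]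
  ring

/-! ## Truncated sums: helicity and its dissipation as differences of critical energies -/

/-- **`H_S = 2(A₊ − A₋)`**, `A± = Σ_{k∈S} |k| E(û±)(k)` — the truncated helicity is the difference
of the `Ḣ^{1/2}`-type energies of the helical components (`∫u·ω = ‖D^{1/2}u₊‖² − ‖D^{1/2}u₋‖²`).
[cite: LeiLinZhou2015, (4-3) (arXiv:1505.00142 p. 5)]
[cite: BiferaleTiti2013, §2 second display (arXiv:1303.1215 p. 4)] -/
theorem truncHelicity_eq_helical (S : Finset (Fin 3 → ℤ)) :
    truncHelicity U S =
      2 * (∑ k ∈ S, Real.sqrt (knormSq k) * modalEnergy (helicalPart 1 U) k -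
        ∑ k ∈ S, Real.sqrt (knormSq k) * modalEnergy (helicalPart (-1) U) k) := by
  unfold truncHelicity
  rw [← Finset.sum_sub_distrib, Finset.mul_sum]
  refine Finset.sum_congr rfl fun k _ => ?_
  rw [modalHelicity_eq_helical]
  ring

/-- **`Σ_{k∈S} |k|² H(k) = 2(B₊ − B₋)`**, `B± = Σ_{k∈S} |k|³ E(û±)(k)` — the helicity dissipation
of the truncated system (`HelicityBalance.helicityDissipation`, `= −∫Δu·ω`) is the difference of
the `Ḣ^{3/2}`-type energies (`∫Δu·ω = −(‖D^{3/2}u₊‖² − ‖D^{3/2}u₋‖²)`).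
[cite: LeiLinZhou2015, (4-4) (arXiv:1505.00142 p. 5)]
[cite: BiferaleTiti2013, §2 third display (arXiv:1303.1215 p. 4)] -/
theorem helicityDissipation_eq_helical (S : Finset (Fin 3 → ℤ)) :
    helicityDissipation U S =
      2 * (∑ k ∈ S, knormSq k * Real.sqrt (knormSq k) * modalEnergy (helicalPart 1 U) k -
        ∑ k ∈ S, knormSq k * Real.sqrt (knormSq k) * modalEnergy (helicalPart (-1) U) k) := by
  unfold helicityDissipation
  rw [← Finset.sum_sub_distrib, Finset.mul_sum]
  refine Finset.sum_congr rfl fun k _ => ?_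
  rw [modalHelicity_eq_helical]
  ring

/-- **`E_S = E_S(û₊) + E_S(û₋)`** for a ZERO-MEAN field (`û(0) = 0`, as in BT13/LLZ).
[cite: BiferaleTiti2013, §2 second display, energy line (arXiv:1303.1215 p. 4)] -/
theorem truncEnergy_eq_add_helical (S : Finset (Fin 3 → ℤ)) (hmean : ∀ j, U.coeff 0 j = 0) :
    truncEnergy U S = truncEnergy (helicalPart 1 U) S + truncEnergy (helicalPart (-1) U) S := by
  unfold truncEnergy
  rw [← Finset.sum_add_distrib]
  refine Finset.sum_congr rfl fun k _ => ?_
  by_cases hk : k = 0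
  · subst hk
    have h1 : ∀ s : ℝ, modalEnergy (helicalPart s U) 0 = 0 := by
      intro s
      unfold modalEnergy
      rw [Finset.sum_eq_zero fun j _ => by rw [helicalPart_coeff_zero, hmean j, mul_zero, map_zero],
        mul_zero]
    have h0 : modalEnergy U 0 = 0 := by
      unfold modalEnergy
      rw [Finset.sum_eq_zero fun j _ => by rw [hmean j, map_zero], mul_zero]
    rw [h1, h1, h0, add_zero]
  · exact modalEnergy_eq_add_helical U hk

/-! ## The Lei–Lin–Zhou identity along the Galerkin system -/

/-- **LLZ15 Thm 1.1, differentiated, for the Galerkin truncation**: along every unforced Galerkin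
solution supported in a symmetric mode set `S` (any `ν`, any pressure multiplier `c`),
`d/dt (A₊ − A₋) = −2ν (B₊ − B₋)` with `A± = Σ_{k∈S}|k|E(û±)(k)` (`½‖D^{1/2}u±‖²`) and
`B± = Σ_{k∈S}|k|³E(û±)(k)` (`½‖D^{3/2}u±‖²`) — one half of the helicity balance
`dH_S/dt = −2ν Σ|k|²H(k)` (`hasDerivAt_truncHelicity_unforced`, LLZ (4-2)) rewritten through
`truncHelicity_eq_helical` / `helicityDissipation_eq_helical` (LLZ (4-3)/(4-4)).
[cite: LeiLinZhou2015, Thm 1.1 and its proof, last display of §2 (arXiv:1505.00142 pp. 3, 5)] -/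
theorem hasDerivAt_criticalEnergy_sub {U : ℝ → FourierVelocity} {S : Finset (Fin 3 → ℤ)} {ν : ℝ}
    {c : ℝ → (Fin 3 → ℤ) → ℂ} (hU : IsGalerkinSolution U S ν c fun _ _ _ => 0)
    (hS : ∀ k ∈ S, -k ∈ S) (hsupp : IsSupportedOn U S) (t : ℝ) :
    HasDerivAt
      (fun τ => ∑ k ∈ S, Real.sqrt (knormSq k) * modalEnergy (helicalPart 1 (U τ)) k -
        ∑ k ∈ S, Real.sqrt (knormSq k) * modalEnergy (helicalPart (-1) (U τ)) k)
      (-(2 * ν) *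
        (∑ k ∈ S, knormSq k * Real.sqrt (knormSq k) * modalEnergy (helicalPart 1 (U t)) k -
          ∑ k ∈ S, knormSq k * Real.sqrt (knormSq k) * modalEnergy (helicalPart (-1) (U t)) k)) t := by
  have h := hasDerivAt_truncHelicity_unforced hU hS hsupp t
  have e : (fun τ => ∑ k ∈ S, Real.sqrt (knormSq k) * modalEnergy (helicalPart 1 (U τ)) k -
        ∑ k ∈ S, Real.sqrt (knormSq k) * modalEnergy (helicalPart (-1) (U τ)) k) =
      fun τ => (1 / 2 : ℝ) * truncHelicity (U τ) S := by
    funext τ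
    rw [truncHelicity_eq_helical]
    ring
  rw [e]
  refine (h.const_mul (1 / 2 : ℝ)).congr_deriv ?_
  rw [helicityDissipation_eq_helical]
  ring

/-- Continuity in time of the `B±`-functionals along a Galerkin solution (each modal energy and modal
helicity of a mode of `S` is differentiable in `t`). [folklore] -/
private theorem continuous_criticalDissipation {U : ℝ → FourierVelocity} {S : Finset (Fin 3 → ℤ)} {ν : ℝ}
    {c : ℝ → (Fin 3 → ℤ) → ℂ} {f : ℝ → (Fin 3 → ℤ) → Fin 3 → ℂ} (hU : IsGalerkinSolution U S ν c f)
    {s : ℝ} (hs : s * s = 1) :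
    Continuous fun τ => ∑ k ∈ S, knormSq k * Real.sqrt (knormSq k) * modalEnergy (helicalPart s (U τ)) k := by
  refine continuous_finsetSum S fun k hk => ?_
  have e : (fun τ => knormSq k * Real.sqrt (knormSq k) * modalEnergy (helicalPart s (U τ)) k) =
      fun τ => knormSq k * ((1 / 2) * Real.sqrt (knormSq k) * modalEnergy (U τ) k +
        s / 4 * modalHelicity (U τ) k) := by
    funext τ
    rw [mul_assoc, sqrt_mul_modalEnergy_helicalPart (U τ) hs k]
  rw [e]
  have hE : Continuous fun τ => modalEnergy (U τ) k :=
    continuous_iff_continuousAt.mpr fun τ => (hasDerivAt_modalEnergy_galerkin hU τ hk).continuousAt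
  have hH : Continuous fun τ => modalHelicity (U τ) k :=
    continuous_iff_continuousAt.mpr fun τ => (hasDerivAt_modalHelicity_galerkin hU τ hk).continuousAt
  exact continuous_const.mul ((continuous_const.mul hE).add (continuous_const.mul hH))

/-- **LLZ15 Thm 1.1 ("Structure of Helicity") for the Galerkin truncation, as printed**: with the
critical energies `E_c(û±)(t) = A±(t) + 2ν∫₀ᵗ B±` (`= ½‖D^{1/2}u±(t)‖² + ν∫₀ᵗ‖D^{3/2}u±‖²`),
`E_c(û₊)(t) = E_c(û₋)(t) + c₀` for all `t`, `c₀ = A₊(0) − A₋(0)` — along every unforced Galerkin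
solution supported in a symmetric `S`.
[cite: LeiLinZhou2015, Thm 1.1 (arXiv:1505.00142 p. 3)] -/
theorem criticalEnergy_posHelical_eq {U : ℝ → FourierVelocity} {S : Finset (Fin 3 → ℤ)} {ν : ℝ}
    {c : ℝ → (Fin 3 → ℤ) → ℂ} (hU : IsGalerkinSolution U S ν c fun _ _ _ => 0)
    (hS : ∀ k ∈ S, -k ∈ S) (hsupp : IsSupportedOn U S) (t : ℝ) :
    (∑ k ∈ S, Real.sqrt (knormSq k) * modalEnergy (helicalPart 1 (U t)) k +
        2 * ν * ∫ τ in (0 : ℝ)..t,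
          ∑ k ∈ S, knormSq k * Real.sqrt (knormSq k) * modalEnergy (helicalPart 1 (U τ)) k) =
      (∑ k ∈ S, Real.sqrt (knormSq k) * modalEnergy (helicalPart (-1) (U t)) k +
        2 * ν * ∫ τ in (0 : ℝ)..t,
          ∑ k ∈ S, knormSq k * Real.sqrt (knormSq k) * modalEnergy (helicalPart (-1) (U τ)) k) +
      (∑ k ∈ S, Real.sqrt (knormSq k) * modalEnergy (helicalPart 1 (U 0)) k -
        ∑ k ∈ S, Real.sqrt (knormSq k) * modalEnergy (helicalPart (-1) (U 0)) k) := by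
  -- names for the four functionals
  set Ap : ℝ → ℝ := fun τ => ∑ k ∈ S, Real.sqrt (knormSq k) * modalEnergy (helicalPart 1 (U τ)) k
    with hAp
  set Am : ℝ → ℝ := fun τ => ∑ k ∈ S, Real.sqrt (knormSq k) * modalEnergy (helicalPart (-1) (U τ)) k
    with hAm
  set Bp : ℝ → ℝ := fun τ =>
    ∑ k ∈ S, knormSq k * Real.sqrt (knormSq k) * modalEnergy (helicalPart 1 (U τ)) k with hBp
  set Bm : ℝ → ℝ := fun τ =>
    ∑ k ∈ S, knormSq k * Real.sqrt (knormSq k) * modalEnergy (helicalPart (-1) (U τ)) k with hBm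
  have hBpc : Continuous Bp := continuous_criticalDissipation hU (s := 1) (by norm_num)
  have hBmc : Continuous Bm := continuous_criticalDissipation hU (s := -1) (by norm_num)
  have hderiv : ∀ x, HasDerivAt (fun τ => Ap τ - Am τ) (-(2 * ν) * (Bp x - Bm x)) x :=
    fun x => hasDerivAt_criticalEnergy_sub hU hS hsupp x
  -- FTC on [0, t]
  have hint : IntervalIntegrable (fun x => -(2 * ν) * (Bp x - Bm x)) MeasureTheory.volume 0 t :=
    ((continuous_const.mul (hBpc.sub hBmc)).intervalIntegrable _ _)
  have hftc := intervalIntegral.integral_eq_sub_of_hasDerivAt (fun x _ => hderiv x) hint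
  -- split the integral
  have hsplit : ∫ x in (0 : ℝ)..t, -(2 * ν) * (Bp x - Bm x) =
      -(2 * ν) * ((∫ x in (0 : ℝ)..t, Bp x) - ∫ x in (0 : ℝ)..t, Bm x) := by
    rw [intervalIntegral.integral_const_mul,
      intervalIntegral.integral_sub (hBpc.intervalIntegrable _ _) (hBmc.intervalIntegrable _ _)]
  rw [hsplit] at hftc
  show Ap t + 2 * ν * (∫ τ in (0 : ℝ)..t, Bp τ) = (Am t + 2 * ν * ∫ τ in (0 : ℝ)..t, Bm τ) + (Ap 0 - Am 0)
  linarith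

end ShellTransfer

end Literature.Analysis.FluidPDE.FluidComputer
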